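/-
Origin: expansion seat `planner-pub-hodgecm-pohl-g15-0`, handover #5 2026-08-18T16:19:39Z (md5 d9bff5338697d06a21b3f40c4ade5760, 243 l.; RUN-32 CANDIDATE ROW, ON REQUEST ONLY — TREE-SHAPE SPLIT (≤400 l.) of the pohl lineage, source lines verbatim; NEW first part; lands AFTER — (imports PKG Geometry.CupFacts, StubTree.Qw8Monomial, Model.Inhabited, StubTree.Inputs); no import rewrite) (`HOME/pub-hodgecm-pohl-g15/lean/Pohl15/KillH0Transform.lean`, md5 d9bff533, 243 lines);
landed by the packager successor (mc-unitary-1-g3, gen-8 kit) in gate run 32 as `HodgeCM/Model/KillH0Transform.lean` (verbatim).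
-/
/-
Copyright: pub-hodgecm formalisation cell (harness21, 2026). New file (not vendored).
Origin: HOME/pub-hodgecm-pohl-g15/lean/Pohl15/KillH0Transform.lean — session planner-pub-hodgecm-pohl-g15-0 (unit pub-hodgecm-pohl-g15),
EXPANSION part (b) `PohlmannSpan`, generation 15: TREE-SHAPE STAGING under the 400-line rule of lean/CONVENTIONS.md §2 — part 1/2
of the split of `HodgeCM/Model/KillH0.lean` (pohl-g7, gate run 25; 516 l., md5 56272adb25be): source lines 60–272 VERBATIM; the module docstring below is new (it only describes the cut).
Intended final place: `HodgeCM/Model/KillH0Transform.lean` (module `HodgeCM.Model.KillH0Transform`); imports final (certified package modules only).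
-/
import Summits.HodgeConjecture.HodgeCM.Geometry.CupFacts
import Summits.HodgeConjecture.HodgeCM.StubTree.Qw8Monomial_3
import Summits.HodgeConjecture.HodgeCM.Model.Inhabited
import Summits.HodgeConjecture.HodgeCM.StubTree.Inputs

/-!
# Killing `H⁰`, I: the universe transform `killH0` and its comparison maps

First half of the former `Model/KillH0.lean` (pohl-g7), split after its §3 (`end KillH0`, source line 272) under the tree's
400-line rule (lean/CONVENTIONS.md §2); every declaration below is the source's, verbatim.  Contents: §0 generic lemmas (a tensor
product with a trivial module is trivial; the zero Hodge structure); §1 the transform `U ↦ U.killH0` (same varieties, morphisms,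
CM data and `H^k`, `k ≥ 1`; `H⁰ := 0`); §2 the comparison maps `toU`, `ofU` and the transport lemmas; §3 transport of the composite
notions (block pairs, diagonal and factor actions, iterated cups).  §4 (`killH0` preserves the model axioms) and §5 (it preserves
N1–N4, F4, F5, `Fact_dimProd`, the realisation input, and kills `H⁰`), with the hypotheses `H0Rigid` / `TrZero`, are in
`KillH0.lean`, which imports this file and keeps the module name.
-/

noncomputable section

open scoped TensorProduct

namespace HodgeCM

open Literature.AlgebraicGeometry.Motives (CMType HodgeStructure)
open Literature.AlgebraicGeometry.Motives.HodgeStructure (EndAction ofRat complexConj)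

/-! ## 0. Generic: the tensor product with a trivial module is trivial; the zero Hodge structure -/

section Zero

variable (V : Type) [AddCommGroup V] [Module ℚ V] [Subsingleton V]

/-- (Ported verbatim from the HodgeCMPerL package; no docstring in the source.) -/
theorem subsingleton_complexified : Subsingleton (ℂ ⊗[ℚ] V) := by
  refine ⟨fun x y => ?_⟩
  have h : ∀ z : ℂ ⊗[ℚ] V, z = 0 := fun z => by
    induction z using TensorProduct.induction_on with
    | zero => rfl
    | tmul a v => rw [Subsingleton.elim v 0, TensorProduct.tmul_zero]
    | add a b ha hb => rw [ha, hb, add_zero]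
  rw [h x, h y]

/-- The unique (zero) Hodge structure of any weight on a trivial `ℚ`-vector space. -/
def zeroHodgeStructure (n : ℤ) : HodgeStructure V n where
  F _ := ⊤
  antitone_F _ _ _ := le_rfl
  exists_F_eq_top := ⟨0, rfl⟩
  exists_F_eq_bot := by
    haveI := subsingleton_complexified V
    haveI := (Submodule.subsingleton_iff ℂ).mpr ‹Subsingleton (ℂ ⊗[ℚ] V)›
    exact ⟨0, Subsingleton.elim _ _⟩
  isCompl_F_complexConj p q _ := by
    haveI := subsingleton_complexified V
    haveI := (Submodule.subsingleton_iff ℂ).mpr ‹Subsingleton (ℂ ⊗[ℚ] V)›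
    rw [Subsingleton.elim (⊤ : Submodule ℂ (ℂ ⊗[ℚ] V)) ⊥, Subsingleton.elim (complexConj _) ⊤]
    exact isCompl_bot_top

end Zero

namespace Universe

variable (U : Universe)

/-! ## 1. The transform `killH0` -/

namespace KillH0

/-- The new cohomology: `0` in degree `0`, `H^k(X, ℚ)` unchanged in degrees `k ≥ 1`. -/
@[reducible] def Coh (X : U.Var) : ℕ → Type
  | 0 => PUnit
  | k + 1 => U.Coh X (k + 1)

/-- (Ported verbatim from the HodgeCMPerL package; no docstring in the source.) -/
@[reducible] instance instAddCommGroup (X : U.Var) : (k : ℕ) → AddCommGroup (Coh U X k)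
  | 0 => inferInstanceAs (AddCommGroup PUnit)
  | k + 1 => inferInstanceAs (AddCommGroup (U.Coh X (k + 1)))

/-- (Ported verbatim from the HodgeCMPerL package; no docstring in the source.) -/
@[reducible] instance instModule (X : U.Var) : (k : ℕ) → Module ℚ (Coh U X k)
  | 0 => inferInstanceAs (Module ℚ PUnit)
  | k + 1 => inferInstanceAs (Module ℚ (U.Coh X (k + 1)))

/-- (Ported verbatim from the HodgeCMPerL package; no docstring in the source.) -/
instance instFinite (X : U.Var) : (k : ℕ) → Module.Finite ℚ (Coh U X k)
  | 0 => inferInstanceAs (Module.Finite ℚ PUnit)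
  | k + 1 => inferInstanceAs (Module.Finite ℚ (U.Coh X (k + 1)))

/-- The Hodge structures: the zero one in degree `0`, unchanged above. -/
@[reducible] def hodge (X : U.Var) : (k : ℕ) → HodgeStructure (Coh U X k) (k : ℤ)
  | 0 => zeroHodgeStructure PUnit ((0 : ℕ) : ℤ)
  | k + 1 => U.hodge X (k + 1)

/-- Algebraic classes: none in degree `0`, unchanged above. -/
@[reducible] def alg (X : U.Var) : (p : ℕ) → Submodule ℚ (Coh U X (2 * p))
  | 0 => ⊥
  | p + 1 => U.alg X (p + 1)

/-- Pull-backs: zero in degree `0`, unchanged above. -/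
@[reducible] def pull {X Y : U.Var} (f : U.Mor X Y) : (k : ℕ) → Coh U Y k →ₗ[ℚ] Coh U X k
  | 0 => 0
  | k + 1 => U.pull f (k + 1)

/-- Cup products: zero when a factor has degree `0`, unchanged otherwise. -/
@[reducible] def cup (X : U.Var) : (i j : ℕ) → Coh U X i →ₗ[ℚ] Coh U X j →ₗ[ℚ] Coh U X (i + j)
  | 0, _ => 0
  | _ + 1, 0 => 0
  | i + 1, j + 1 => U.cup X (i + 1) (j + 1)

/-- Traces: zero in degree `0`, unchanged above. -/
@[reducible] def tr (X : U.Var) : (k : ℕ) → Coh U X k →ₗ[ℚ] ℚ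
  | 0 => 0
  | k + 1 => U.tr X (k + 1)

end KillH0

/-- **The transform `U ↦ U♭ = U.killH0`**: the same varieties, morphisms, products, CM abelian varieties, CM actions,
Picard modular surfaces and dimensions; the same `H^k`, Hodge structures, algebraic classes, pull-backs, cup products
and traces in all degrees `k ≥ 1`; and `H⁰(X) := 0` for every `X`. -/
@[reducible] def killH0 : Universe :=
  { U with
    Coh := KillH0.Coh U
    instAddCommGroup := KillH0.instAddCommGroup U
    instModule := KillH0.instModule U
    instFinite := KillH0.instFinite U
    hodge := KillH0.hodge U
    alg := KillH0.alg U
    pull := fun f => KillH0.pull U f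
    cup := KillH0.cup U
    tr := KillH0.tr U
    cmAct := fun K Φ => U.cmAct K Φ }

namespace KillH0

variable {U}

/-! ## 2. The comparison maps `toU`, `ofU` and the transport lemmas -/

/-- (Ported verbatim from the HodgeCMPerL package; no docstring in the source.) -/
instance subsingleton_coh_zero (X : U.Var) : Subsingleton (U.killH0.Coh X 0) :=
  inferInstanceAs (Subsingleton PUnit)

/-- (Ported verbatim from the HodgeCMPerL package; no docstring in the source.) -/
instance subsingleton_cohC_zero (X : U.Var) : Subsingleton (U.killH0.CohC X 0) :=
  subsingleton_complexified _

/-- `H^k_♭(X) → H^k(X)`: zero in degree `0`, the identity above. -/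
def toU (X : U.Var) : (k : ℕ) → U.killH0.Coh X k →ₗ[ℚ] U.Coh X k
  | 0 => 0
  | _ + 1 => LinearMap.id

/-- `H^k(X) → H^k_♭(X)`: zero in degree `0`, the identity above. -/
def ofU (X : U.Var) : (k : ℕ) → U.Coh X k →ₗ[ℚ] U.killH0.Coh X k
  | 0 => 0
  | _ + 1 => LinearMap.id

/-- (Ported verbatim from the HodgeCMPerL package; no docstring in the source.) -/
@[simp] theorem toU_succ (X : U.Var) (k : ℕ) (x : U.killH0.Coh X (k + 1)) : toU X (k + 1) x = x := rfl

/-- (Ported verbatim from the HodgeCMPerL package; no docstring in the source.) -/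
@[simp] theorem ofU_succ (X : U.Var) (k : ℕ) (x : U.Coh X (k + 1)) : ofU X (k + 1) x = x := rfl

/-- (Ported verbatim from the HodgeCMPerL package; no docstring in the source.) -/
theorem toU_zero_deg (X : U.Var) (x : U.killH0.Coh X 0) : toU X 0 x = 0 := rfl

/-- (Ported verbatim from the HodgeCMPerL package; no docstring in the source.) -/
theorem ofU_toU (X : U.Var) (k : ℕ) (x : U.killH0.Coh X k) : ofU X k (toU X k x) = x := by
  cases k
  · exact Subsingleton.elim _ _
  · rfl

/-- (Ported verbatim from the HodgeCMPerL package; no docstring in the source.) -/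
theorem toU_ofU (X : U.Var) {k : ℕ} (hk : k ≠ 0) (x : U.Coh X k) : toU X k (ofU X k x) = x := by
  cases k
  · exact absurd rfl hk
  · rfl

/-- (Ported verbatim from the HodgeCMPerL package; no docstring in the source.) -/
theorem toU_injective (X : U.Var) (k : ℕ) : Function.Injective (toU X k) := fun x y h => by
  rw [← ofU_toU X k x, h, ofU_toU]

/-- (Ported verbatim from the HodgeCMPerL package; no docstring in the source.) -/
theorem toU_bijective (X : U.Var) {k : ℕ} (hk : k ≠ 0) : Function.Bijective (toU X k) :=
  ⟨toU_injective X k, fun y => ⟨ofU X k y, toU_ofU X hk y⟩⟩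

/-- (Ported verbatim from the HodgeCMPerL package; no docstring in the source.) -/
theorem ofU_bijective (X : U.Var) {k : ℕ} (hk : k ≠ 0) : Function.Bijective (ofU X k) := by
  obtain ⟨k, rfl⟩ := Nat.exists_eq_succ_of_ne_zero hk
  exact Function.bijective_id

/-- (Ported verbatim from the HodgeCMPerL package; no docstring in the source.) -/
theorem toU_pull {X Y : U.Var} (f : U.Mor X Y) (k : ℕ) (y : U.killH0.Coh Y k) :
    toU X k (U.killH0.pull f k y) = U.pull f k (toU Y k y) := by
  cases k
  · rw [toU_zero_deg, toU_zero_deg, map_zero]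
  · rfl

/-- (Ported verbatim from the HodgeCMPerL package; no docstring in the source.) -/
theorem toU_cup (X : U.Var) (i j : ℕ) (x : U.killH0.Coh X i) (y : U.killH0.Coh X j) :
    toU X (i + j) (U.killH0.cup X i j x y) = U.cup X i j (toU X i x) (toU X j y) := by
  cases i with
  | zero =>
    have h1 : U.killH0.cup X 0 j x y = 0 := rfl
    rw [h1, map_zero (toU X (0 + j)), toU_zero_deg, map_zero (U.cup X 0 j), LinearMap.zero_apply]
  | succ i =>
    cases j with
    | zero =>
      have h1 : U.killH0.cup X (i + 1) 0 x y = 0 := rfl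
      rw [h1, map_zero (toU X (i + 1 + 0)), toU_zero_deg, map_zero (U.cup X (i + 1) 0 (toU X (i + 1) x))]
    | succ j => rfl

/-- (Ported verbatim from the HodgeCMPerL package; no docstring in the source.) -/
theorem tr_eq (X : U.Var) (k : ℕ) (x : U.killH0.Coh X k) : U.killH0.tr X k x = U.tr X k (toU X k x) := by
  cases k
  · rw [toU_zero_deg, map_zero (U.tr X 0)]; rfl
  · rfl

/-- (Ported verbatim from the HodgeCMPerL package; no docstring in the source.) -/
theorem mem_alg_iff (X : U.Var) (p : ℕ) (x : U.killH0.Coh X (2 * p)) :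
    x ∈ U.killH0.alg X p ↔ toU X (2 * p) x ∈ U.alg X p := by
  cases p with
  | zero =>
    constructor
    · intro _
      exact (toU_zero_deg X x).symm ▸ Submodule.zero_mem _
    · intro _
      exact (Subsingleton.elim x 0).symm ▸ Submodule.zero_mem _
  | succ p => exact Iff.rfl

/-- (Ported verbatim from the HodgeCMPerL package; no docstring in the source.) -/
theorem toU_castCoh (X : U.Var) {k l : ℕ} (h : k = l) (x : U.killH0.Coh X k) :
    toU X l (U.killH0.castCoh X h x) = U.castCoh X h (toU X k x) := by
  subst h; rfl

/-- (Ported verbatim from the HodgeCMPerL package; no docstring in the source.) -/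
theorem toU_smul (X : U.Var) (k : ℕ) (c : ℚ) (x : U.killH0.Coh X k) : toU X k (c • x) = c • toU X k x :=
  map_smul _ _ _

/-! ## 3. Transport of the composite notions (block pairs, diagonal and factor actions, iterated cups) -/

/-- (Ported verbatim from the HodgeCMPerL package; no docstring in the source.) -/
theorem cupPow_eq (X : U.Var) : ∀ (k : ℕ) (a : Fin (k + 1) → U.killH0.Coh X 1),
    U.killH0.cupPow X k a = U.cupPow X k a
  | 0, _ => rfl
  | k + 1, a => by rw [cupPow_succ, cupPow_succ, cupPow_eq X k]

set_option smartUnfolding false in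
/-- (Ported verbatim from the HodgeCMPerL package; no docstring in the source.) -/
theorem isFactorAct_iff {F : CMField} {n : ℕ} (Θ : Fin (n + 1) → CMType F) (j : Fin (n + 1)) (a : F)
    (M : U.Mor (U.cmProd F Θ) (U.cmProd F Θ)) :
    U.killH0.IsFactorAct F Θ j a M ↔ U.IsFactorAct F Θ j a M := Iff.rfl

end KillH0

end Universe

end HodgeCM

end
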